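import Summits.ABC.IUTFork.Joshi.TestIndeterminacies
import Summits.ABC.IUTFork.Joshi.DictionaryCollation
import Summits.ABC.IUTFork.Joshi.TestRealInstantiation
import HarnessLib

/-!
# Block-E TEST file: the T-18 / D-10 dictionary hypotheses (Joshi's §8.11 indeterminacy moves and Prop 9.7.5.1 collation, [J-III]
# = arXiv:2401.13508v4) at GENERATOR-PRESERVING CONTAINERS and at the tree's REAL Dupuy–Hilado-level instantiation (X-06-REAL ∘ T-18)

Test file of the abc-iut cell, branch E «type Joshi's construction, test vs S» (rung LADDER-ABC:A2.E; seat abc-iut-E-t18; R14 Test side).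
**No side is taken** on [IUTchIII] Cor. 3.12, on Joshi's claims, or on Mochizuki's report on them; Joshi's papers are unrefereed preprints;
typed ≠ proved ≠ endorsed; located ≠ adjudicated. NO abc claim.

WHAT IS COMPOSED (everything imported BY NAME). T-18's `untiltChangeIsInd_of_hyps` (every label-wise composite of §8.11 moves realised
under `JInd2InIsm ∧ JInd1InStripAut` is an `UntiltChangeIsInd` family) and `pilotKummerIndRelated_of_seed` (Joshi/TestIndeterminacies.lean,
p429633); D-10's `ansatzWithinInd_of_factorsThroughBoth` (Joshi/DictionaryCollation.lean, p430230); E-t43's X-06 at generator-preserving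
summand containers and at the REAL instantiation — `not_untiltChange_of_realizes`, `not_ansatzWithinInd_and_standardPointIsQPilot_of_realizes`,
`realizes_latticeSituationDHVol`, `generatorsPreserve_summandPiecesDH` (Joshi/TestRealInstantiation.lean, p430041: there (Ind1)/(Ind2)
transport admissibility and PRESERVE LOG-VOLUME as THEOREMS — abc-iut-c312-5's `SummandPieces`, Dupuy–Hilado's lattice-preserving `ismDH`).

RESULTS (J-FALSE-AT-REAL data in the grammar of E-PLAN R9/R13; located, not adjudicated):
* (§1, class level) for line data realising a generator-preserving summand container and honest exponents at one packet: for EVERY Joshi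
  datum, EVERY T-18 dictionary and EVERY label-wise family of §8.11 moves, `JInd2InIsm ∧ JInd1InStripAut ⟹ ¬ UntiltChangeCoversQ`
  (`not_coversQ_of_realizes_of_hyps`); and given the seed's other components (+ `FactorsThrough`, resp. + a D-10 dictionary with
  `CollationInInd` and `FactorsThroughBoth`), the T-18 hypotheses (resp. the three located Props) are REFUTED there
  (`not_hyps_of_seed_of_realizes`, `not_three_of_seed_of_realizes`).
* (§2, the tree's REAL instantiation `latticeSituationDHVol`: the situation of Thm 3.11 over the Dupuy–Hilado-level log-shells
  `Thm311.Real.logShellsDH X logv` with the verbatim volumes, ANY family of columns, ANY Cor-3.12 setting over it, ANY `ρ`, `qK`) the same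
  three statements with every volume hypothesis discharged by the tree (`realDH_not_coversQ_of_hyps`, `realDH_not_hyps_of_seed`,
  `realDH_not_three_of_seed`).
LOCATED SENTENCE (no side; T-18's line of E-LOCATION §L1 made real): at the tree's honest real instantiation — where Mochizuki's (Ind2) is
Dupuy–Hilado's isometric `ismDH` — Joshi's §8.11 moves and his collation, read through ANY dictionary satisfying `JInd2InIsm ∧
JInd1InStripAut ∧ CollationInInd`, cannot carry a Θ-Kummer region over the q-region, and the FILLS-MODULO-Y line of T-18 has no satisfying
instance there; where it has one is X-07′ (an (Ind2) enlarged by a valuation-rescaling, E-t41). [claim: Joshi2024ATS3, status: disputed];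
our side [claim: Mochizuki2012, status: disputed]; [cite: DupuyHilado2025, §4.7–4.9]. Standard axioms only.
-/

noncomputable section

namespace Summit.ABC.IUTFork.Joshi.ATS3.IndDictionary

open Function Set Thm311 Cor312 Cor312Vol Joshi

/-! ## 1. Class level: generator-preserving summand containers (E-t43's `…_of_realizes`) -/

section Container

variable {T : ThetaIndex} {S : LatticeSituation T} {P : Cor312.Setting S.toSituation}
  {ρ : (∀ v : T.V, v ∈ T.Vbad → Set (S.L.StarPacket v)) → ∀ (j : T.Label) (vQ : T.VQ), Set (S.L.Packet j vQ)}
  {qK : ∀ v : T.V, v ∈ T.Vbad → Set (S.L.StarPacket v)} {V : SummandPieces S.L}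
  {𝔍 : RosettaIndDatum} (𝔇' : IndDictionary 𝔍 S.L)

/-- **§8.11 moves cannot cover q at a generator-preserving container**: for line data realising a generator-preserving summand container and
honest exponents at one packet, every label-wise composite of §8.11 moves realised under `JInd2InIsm ∧ JInd1InStripAut` FAILS Joshi's
containment side `UntiltChangeCoversQ` (E-t43's `not_untiltChange_of_realizes` ∘ T-18's `untiltChangeIsInd_of_hyps`).
[claim: Mochizuki2012, status: disputed] -/
theorem not_coversQ_of_realizes_of_hyps (hD : V.Realizes (S.D P.n)) (hG : V.GeneratorsPreserve)
    {i : Fin T.lstar} {vQ : T.VQ}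
    (hq : (S.D P.n).Adm (Setting.labelSucc i) vQ (ρ qK (Setting.labelSucc i) vQ))
    (hΘ : ∀ m : ℤ, (S.D P.n).Adm (Setting.labelSucc i) vQ (ρ ((S.col P.n).frobΨ m) (Setting.labelSucc i) vQ))
    (hlt : ∀ m : ℤ, (S.D P.n).logvol (Setting.labelSucc i) vQ (ρ ((S.col P.n).frobΨ m) (Setting.labelSucc i) vQ) <
      (S.D P.n).logvol (Setting.labelSucc i) vQ (ρ qK (Setting.labelSucc i) vQ))
    (h2 : 𝔇'.JInd2InIsm) (h1 : 𝔇'.JInd1InStripAut) (μ : T.Label → List (JMove 𝔍)) :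
    ¬ UntiltChangeCoversQ S P ρ qK (𝔇'.untiltFamily μ) := fun hcov =>
  not_untiltChange_of_realizes hD hG hq hΘ hlt (𝔇'.untiltFamily μ) ⟨𝔇'.untiltChangeIsInd_of_hyps h2 h1 μ, hcov⟩

/-- **The T-18 hypotheses are refuted at a generator-preserving container, given the seed's other components** (Thm 3.11 (ii)(b) for
column `n`, (hρ), honest exponents at one packet; seed `𝔈` with `FactorsThrough ∧ BaseIsThetaPilot ∧ DatumEquivariant ∧ StdReachable ∧
StandardPointIsQPilot`): `¬ (JInd2InIsm ∧ JInd1InStripAut)`. (E-t43's `not_ansatzWithinInd_and_standardPointIsQPilot_of_realizes` ∘ T-18's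
`ansatzWithinInd_of_factorsThrough`.) [claim: Joshi2024ATS3, status: disputed] -/
theorem not_hyps_of_seed_of_realizes (𝔈 : Joshi.Dictionary S) (hD : V.Realizes (S.D P.n)) (hG : V.GeneratorsPreserve)
    (hKumB : (S.col P.n).KummerB (S.D P.n))
    (hρ : ∀ Φ ∈ Subgroup.closure (S.L.Ind1Family ∪ S.L.Ind2Family),
      ∀ (Ψ : ∀ v : T.V, v ∈ T.Vbad → Set (S.L.StarPacket v)) (j : T.Label) (vQ : T.VQ),
        ρ (fun v hv => S.L.starAut Φ v '' Ψ v hv) j vQ = Φ j vQ '' ρ Ψ j vQ)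
    {i : Fin T.lstar} {vQ : T.VQ}
    (hq : (S.D P.n).Adm (Setting.labelSucc i) vQ (ρ qK (Setting.labelSucc i) vQ))
    (hΘ : ∀ m : ℤ, (S.D P.n).Adm (Setting.labelSucc i) vQ (ρ ((S.col P.n).frobΨ m) (Setting.labelSucc i) vQ))
    (hlt : ∀ m : ℤ, (S.D P.n).logvol (Setting.labelSucc i) vQ (ρ ((S.col P.n).frobΨ m) (Setting.labelSucc i) vQ) <
      (S.D P.n).logvol (Setting.labelSucc i) vQ (ρ qK (Setting.labelSucc i) vQ))
    (hB : Joshi.BaseIsThetaPilot 𝔈 (P := P)) (hE : Joshi.DatumEquivariant 𝔈) (hR : Joshi.StdReachable 𝔈)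
    (hf : 𝔇'.FactorsThrough 𝔈) (hY2 : Joshi.StandardPointIsQPilot ρ qK 𝔈) :
    ¬ (𝔇'.JInd2InIsm ∧ 𝔇'.JInd1InStripAut) := fun h =>
  not_ansatzWithinInd_and_standardPointIsQPilot_of_realizes 𝔈 hD hG hKumB hρ hq hΘ hlt
    ⟨𝔇'.ansatzWithinInd_of_factorsThrough 𝔈 ρ hB hE hR h.1 h.2 hf, hY2⟩

/-- **The THREE located Props (T-18 + D-10) are refuted there for the FULL move set**: with a collation dictionary `𝔠` and
`FactorsThroughBoth`, `¬ (JInd2InIsm ∧ JInd1InStripAut ∧ CollationInInd)` at a generator-preserving container, given the seed's other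
components. (D-10's `ansatzWithinInd_of_factorsThroughBoth`.) [claim: Joshi2024ATS3, status: disputed] -/
theorem not_three_of_seed_of_realizes {Y : Type*} {W : Type*} {H : Y → W → Type*} {C : ClassCollationDatum Y W H}
    (𝔠 : CollationDictionary C S.L) (𝔈 : Joshi.Dictionary S) (hD : V.Realizes (S.D P.n)) (hG : V.GeneratorsPreserve)
    (hKumB : (S.col P.n).KummerB (S.D P.n))
    (hρ : ∀ Φ ∈ Subgroup.closure (S.L.Ind1Family ∪ S.L.Ind2Family),
      ∀ (Ψ : ∀ v : T.V, v ∈ T.Vbad → Set (S.L.StarPacket v)) (j : T.Label) (vQ : T.VQ),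
        ρ (fun v hv => S.L.starAut Φ v '' Ψ v hv) j vQ = Φ j vQ '' ρ Ψ j vQ)
    {i : Fin T.lstar} {vQ : T.VQ}
    (hq : (S.D P.n).Adm (Setting.labelSucc i) vQ (ρ qK (Setting.labelSucc i) vQ))
    (hΘ : ∀ m : ℤ, (S.D P.n).Adm (Setting.labelSucc i) vQ (ρ ((S.col P.n).frobΨ m) (Setting.labelSucc i) vQ))
    (hlt : ∀ m : ℤ, (S.D P.n).logvol (Setting.labelSucc i) vQ (ρ ((S.col P.n).frobΨ m) (Setting.labelSucc i) vQ) <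
      (S.D P.n).logvol (Setting.labelSucc i) vQ (ρ qK (Setting.labelSucc i) vQ))
    (hB : Joshi.BaseIsThetaPilot 𝔈 (P := P)) (hE : Joshi.DatumEquivariant 𝔈) (hR : Joshi.StdReachable 𝔈)
    (hf : 𝔠.FactorsThroughBoth 𝔇' 𝔈) (hY2 : Joshi.StandardPointIsQPilot ρ qK 𝔈) :
    ¬ (𝔇'.JInd2InIsm ∧ 𝔇'.JInd1InStripAut ∧ 𝔠.CollationInInd) := fun h =>
  not_ansatzWithinInd_and_standardPointIsQPilot_of_realizes 𝔈 hD hG hKumB hρ hq hΘ hlt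
    ⟨𝔠.ansatzWithinInd_of_factorsThroughBoth 𝔇' 𝔈 ρ hB hE hR h.1 h.2.1 h.2.2 hf, hY2⟩

end Container

/-! ## 2. At the tree's REAL Dupuy–Hilado-level instantiation (every volume hypothesis discharged by the tree) -/

section RealDH

open Thm311.Real Literature.IUT.LogVolume

variable {F : Type} [Field F] [NumberField F] (X : PilotData F) {logv : PadicLogs F} (hlog : LogvAnalytic logv)
  (M : Type) [Field M] [NumberField M]
  (archPk : ∀ (j : (thetaIndex X).Label) (vQ : (thetaIndex X).VQ), Set ((logShellsDH X logv).Packet j vQ))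
  (archSub : ∀ (j : (thetaIndex X).Label) (v : (thetaIndex X).V),
    Set ((logShellsDH X logv).Packet j ((thetaIndex X).over v)))
  (Ψ : ℤ → ∀ v : (thetaIndex X).V, v ∈ (thetaIndex X).Vbad → Set ((logShellsDH X logv).StarPacket v))
  (act : ℤ → ∀ v : (thetaIndex X).V, v ∈ (thetaIndex X).Vbad →
    (logShellsDH X logv).StarPacket v → Module.End ℚ ((logShellsDH X logv).StarPacket v))
  (Mmod : ℤ → ∀ j : (thetaIndex X).LabelStar, Set ((logShellsDH X logv).GlobalPacket j.1))
  (region : ℤ → ∀ j : (thetaIndex X).LabelStar, FinDivisor M → ∀ vQ : (thetaIndex X).VQ,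
    Set ((logShellsDH X logv).Packet j.1 vQ))
  (col : ℤ → Column (logShellsDH X logv))
  {P : Cor312.Setting (latticeSituationDHVol X hlog M archPk archSub Ψ act Mmod region col).toSituation}
  {ρ : (∀ v : (thetaIndex X).V, v ∈ (thetaIndex X).Vbad → Set ((logShellsDH X logv).StarPacket v)) →
    ∀ (j : (thetaIndex X).Label) (vQ : (thetaIndex X).VQ), Set ((logShellsDH X logv).Packet j vQ)}
  {qK : ∀ v : (thetaIndex X).V, v ∈ (thetaIndex X).Vbad → Set ((logShellsDH X logv).StarPacket v)}
  {𝔍 : RosettaIndDatum} (𝔇' : IndDictionary 𝔍 (logShellsDH X logv))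

/-- **§8.11 moves cannot cover q AT THE REAL INSTANTIATION**: over the Dupuy–Hilado-level log-shells with the verbatim volumes (ANY columns,
ANY Cor-3.12 setting, ANY `ρ`, `qK`), honest exponents at one packet ⟹ for every Joshi datum, every T-18 dictionary and every label-wise
family of §8.11 moves, `JInd2InIsm ∧ JInd1InStripAut ⟹ ¬ UntiltChangeCoversQ`. There (Ind2) = `ismDH` (lattice-preserving, isometric):
Joshi's valuation-rescaling σ ([J-III] p.91 l.44–46) read INTO it is volume-preserving, so it cannot do what print needs it to do. Located,
not adjudicated. [cite: DupuyHilado2025, §4.9] -/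
theorem realDH_not_coversQ_of_hyps {i : Fin (thetaIndex X).lstar} {vQ : (thetaIndex X).VQ}
    (hq : ((latticeSituationDHVol X hlog M archPk archSub Ψ act Mmod region col).D P.n).Adm (Setting.labelSucc i) vQ
      (ρ qK (Setting.labelSucc i) vQ))
    (hΘ : ∀ m : ℤ, ((latticeSituationDHVol X hlog M archPk archSub Ψ act Mmod region col).D P.n).Adm
      (Setting.labelSucc i) vQ (ρ ((col P.n).frobΨ m) (Setting.labelSucc i) vQ))
    (hlt : ∀ m : ℤ, ((latticeSituationDHVol X hlog M archPk archSub Ψ act Mmod region col).D P.n).logvol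
        (Setting.labelSucc i) vQ (ρ ((col P.n).frobΨ m) (Setting.labelSucc i) vQ) <
      ((latticeSituationDHVol X hlog M archPk archSub Ψ act Mmod region col).D P.n).logvol (Setting.labelSucc i) vQ
        (ρ qK (Setting.labelSucc i) vQ))
    (h2 : 𝔇'.JInd2InIsm) (h1 : 𝔇'.JInd1InStripAut) (μ : (thetaIndex X).Label → List (JMove 𝔍)) :
    ¬ UntiltChangeCoversQ (latticeSituationDHVol X hlog M archPk archSub Ψ act Mmod region col) P ρ qK
        (IndDictionary.untiltFamily (S := latticeSituationDHVol X hlog M archPk archSub Ψ act Mmod region col) 𝔇' μ) :=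
  not_coversQ_of_realizes_of_hyps (S := latticeSituationDHVol X hlog M archPk archSub Ψ act Mmod region col) 𝔇'
    (realizes_latticeSituationDHVol X hlog M archPk archSub Ψ act Mmod region col P.n)
    (generatorsPreserve_summandPiecesDH X hlog) hq hΘ hlt h2 h1 μ

/-- **The T-18 hypotheses are REFUTED at the real instantiation, given the seed's other components** (Thm 3.11 (ii)(b) for column `n`,
(hρ), honest exponents at one packet). [claim: Joshi2024ATS3, status: disputed] [cite: DupuyHilado2025, §4.9] -/
theorem realDH_not_hyps_of_seed
    (𝔈 : Joshi.Dictionary (latticeSituationDHVol X hlog M archPk archSub Ψ act Mmod region col))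
    (hKumB : (col P.n).KummerB ((latticeSituationDHVol X hlog M archPk archSub Ψ act Mmod region col).D P.n))
    (hρ : ∀ Φ ∈ Subgroup.closure ((logShellsDH X logv).Ind1Family ∪ (logShellsDH X logv).Ind2Family),
      ∀ (Ψ' : ∀ v : (thetaIndex X).V, v ∈ (thetaIndex X).Vbad → Set ((logShellsDH X logv).StarPacket v))
        (j : (thetaIndex X).Label) (vQ : (thetaIndex X).VQ),
        ρ (fun v hv => (logShellsDH X logv).starAut Φ v '' Ψ' v hv) j vQ = Φ j vQ '' ρ Ψ' j vQ)
    {i : Fin (thetaIndex X).lstar} {vQ : (thetaIndex X).VQ}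
    (hq : ((latticeSituationDHVol X hlog M archPk archSub Ψ act Mmod region col).D P.n).Adm (Setting.labelSucc i) vQ
      (ρ qK (Setting.labelSucc i) vQ))
    (hΘ : ∀ m : ℤ, ((latticeSituationDHVol X hlog M archPk archSub Ψ act Mmod region col).D P.n).Adm
      (Setting.labelSucc i) vQ (ρ ((col P.n).frobΨ m) (Setting.labelSucc i) vQ))
    (hlt : ∀ m : ℤ, ((latticeSituationDHVol X hlog M archPk archSub Ψ act Mmod region col).D P.n).logvol
        (Setting.labelSucc i) vQ (ρ ((col P.n).frobΨ m) (Setting.labelSucc i) vQ) <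
      ((latticeSituationDHVol X hlog M archPk archSub Ψ act Mmod region col).D P.n).logvol (Setting.labelSucc i) vQ
        (ρ qK (Setting.labelSucc i) vQ))
    (hB : Joshi.BaseIsThetaPilot 𝔈 (P := P)) (hE : Joshi.DatumEquivariant 𝔈) (hR : Joshi.StdReachable 𝔈)
    (hf : IndDictionary.FactorsThrough (S := latticeSituationDHVol X hlog M archPk archSub Ψ act Mmod region col) 𝔇' 𝔈)
    (hY2 : Joshi.StandardPointIsQPilot ρ qK 𝔈) :
    ¬ (𝔇'.JInd2InIsm ∧ 𝔇'.JInd1InStripAut) :=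
  not_hyps_of_seed_of_realizes (S := latticeSituationDHVol X hlog M archPk archSub Ψ act Mmod region col) 𝔇' 𝔈
    (realizes_latticeSituationDHVol X hlog M archPk archSub Ψ act Mmod region col P.n)
    (generatorsPreserve_summandPiecesDH X hlog) hKumB hρ hq hΘ hlt hB hE hR hf hY2

/-- **The three located Props (T-18 + D-10) are REFUTED at the real instantiation for the FULL move set**, given the seed's other
components and `FactorsThroughBoth`. [claim: Joshi2024ATS3, status: disputed] [cite: DupuyHilado2025, §4.9] -/
theorem realDH_not_three_of_seed {Y : Type*} {W : Type*} {H : Y → W → Type*} {C : ClassCollationDatum Y W H}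
    (𝔠 : CollationDictionary C (logShellsDH X logv))
    (𝔈 : Joshi.Dictionary (latticeSituationDHVol X hlog M archPk archSub Ψ act Mmod region col))
    (hKumB : (col P.n).KummerB ((latticeSituationDHVol X hlog M archPk archSub Ψ act Mmod region col).D P.n))
    (hρ : ∀ Φ ∈ Subgroup.closure ((logShellsDH X logv).Ind1Family ∪ (logShellsDH X logv).Ind2Family),
      ∀ (Ψ' : ∀ v : (thetaIndex X).V, v ∈ (thetaIndex X).Vbad → Set ((logShellsDH X logv).StarPacket v))
        (j : (thetaIndex X).Label) (vQ : (thetaIndex X).VQ),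
        ρ (fun v hv => (logShellsDH X logv).starAut Φ v '' Ψ' v hv) j vQ = Φ j vQ '' ρ Ψ' j vQ)
    {i : Fin (thetaIndex X).lstar} {vQ : (thetaIndex X).VQ}
    (hq : ((latticeSituationDHVol X hlog M archPk archSub Ψ act Mmod region col).D P.n).Adm (Setting.labelSucc i) vQ
      (ρ qK (Setting.labelSucc i) vQ))
    (hΘ : ∀ m : ℤ, ((latticeSituationDHVol X hlog M archPk archSub Ψ act Mmod region col).D P.n).Adm
      (Setting.labelSucc i) vQ (ρ ((col P.n).frobΨ m) (Setting.labelSucc i) vQ))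
    (hlt : ∀ m : ℤ, ((latticeSituationDHVol X hlog M archPk archSub Ψ act Mmod region col).D P.n).logvol
        (Setting.labelSucc i) vQ (ρ ((col P.n).frobΨ m) (Setting.labelSucc i) vQ) <
      ((latticeSituationDHVol X hlog M archPk archSub Ψ act Mmod region col).D P.n).logvol (Setting.labelSucc i) vQ
        (ρ qK (Setting.labelSucc i) vQ))
    (hB : Joshi.BaseIsThetaPilot 𝔈 (P := P)) (hE : Joshi.DatumEquivariant 𝔈) (hR : Joshi.StdReachable 𝔈)
    (hf : CollationDictionary.FactorsThroughBoth (S := latticeSituationDHVol X hlog M archPk archSub Ψ act Mmod region col)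
      𝔠 𝔇' 𝔈)
    (hY2 : Joshi.StandardPointIsQPilot ρ qK 𝔈) :
    ¬ (𝔇'.JInd2InIsm ∧ 𝔇'.JInd1InStripAut ∧ 𝔠.CollationInInd) :=
  not_three_of_seed_of_realizes (S := latticeSituationDHVol X hlog M archPk archSub Ψ act Mmod region col) 𝔇' 𝔠 𝔈
    (realizes_latticeSituationDHVol X hlog M archPk archSub Ψ act Mmod region col P.n)
    (generatorsPreserve_summandPiecesDH X hlog) hKumB hρ hq hΘ hlt hB hE hR hf hY2

end RealDH

end Summit.ABC.IUTFork.Joshi.ATS3.IndDictionary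

end
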